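import Summits.QuantumAdvantage.QuantumAdvantage.Theorems.LinnikCubicClassGroupsPureCubicClassGroupFBQPStubClassTableSemWalkPkg
import Summits.QuantumAdvantage.QuantumAdvantage.Theorems.LinnikCubicClassGroupsPureCubicClassGroupFBQPStubClassTableSemNumerics2
import Literature.Computability.Cryptography.CubicClassTableSemPow

/-!
# Crux `LinnikCubicClassGroups.PureCubicClassGroupFBQP` (stmt-QuantumAdvantage-11544) — stub `stub_semMain`, part SETUP

Line `arakelov-giant-step-cycle`, stub `stub_semMain` (S5b-P5b-M, the composition of the table semantics `ClaimTableSem`):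
instance-level facts of the ladder class table used by the per-position core and the assembly —

* `inst_pos_decomp` — the layout of a position `v = E + W j` (`E < W = (2^ℓe)^T`, `j < 2^ℓy`): exponent block, grid index,
  digits and the integer target `t̂ = (j mod 2^s) r 2^(prec−k−s)`;
* `inst_numerics` — the numeric side conditions that the parameter inequalities of `ClassTableInterfaceQ3` imply
  (`4 size(ab) + 8 ≤ prec`, `9 ≤ prec`, `4 ≤ k`, …);
* `regulator_sixteenth_le`, `logB_le_pow_six`, `three_div_le_logB`, `Rint_ge` — the small analytic inequalities feeding
  `num_BN` / `num_etaerr` / `num_defect_card` (`R ≥ 1/16` from the six-gap period bound, `LB = log(3√|d_K|) ≤ |d_K|⁶`,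
  `3/2^prec ≤ LB`, `2^prec/16 ≤ Rint`).
-/

set_option linter.dupNamespace false

namespace Summit.QuantumAdvantage.QuantumAdvantage.Theorems.LinnikCubicClassGroups

open scoped NumberField nonZeroDivisors
open NumberField
open Literature.Computability.Cryptography
open Literature.Computability.Cryptography.CubicClassTable

/-- **Layout of a position.** For `E < W` and `j < 2^ℓy`, the position `v = E + W j` has exponent block `E`, grid index `j`,
digits `E / (2^ℓe)^t mod 2^ℓe` and target `t̂ = (j mod 2^s)·r·2^(prec−k−s)`. -/
theorem inst_pos_decomp (I : Inst) {E j : ℕ} (hE : E < I.W) (hj : j < 2 ^ I.ℓy) :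
    I.Eof (E + I.W * j) = E ∧ I.jof (E + I.W * j) = j ∧
      (∀ t, I.digit (E + I.W * j) t = E / (2 ^ I.ℓe) ^ t % 2 ^ I.ℓe) ∧
      I.tgt (E + I.W * j) = (j % 2 ^ I.s) * I.r * 2 ^ (I.prec - I.k - I.s) := by
  have hW : 0 < I.W := lt_of_le_of_lt (Nat.zero_le E) hE
  have hEof : I.Eof (E + I.W * j) = E := by
    unfold Inst.Eof; rw [Nat.add_mul_mod_self_left, Nat.mod_eq_of_lt hE]
  have hjof : I.jof (E + I.W * j) = j := by
    unfold Inst.jof; rw [Nat.add_mul_div_left _ _ hW, Nat.div_eq_of_lt hE, zero_add, Nat.mod_eq_of_lt hj]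
  refine ⟨hEof, hjof, fun t => ?_, ?_⟩
  · unfold Inst.digit; rw [hEof]; rfl
  · unfold Inst.tgt; rw [hjof]

/-- `size (a b) ≤ size (27 a² b²)`. -/
theorem size_ab_le {a b : ℕ} (ha : a ≠ 0) (hb : b ≠ 0) : Nat.size (a * b) ≤ Nat.size (27 * a ^ 2 * b ^ 2) := by
  apply Nat.size_le_size
  have h1 : 1 ≤ a * b := Nat.one_le_iff_ne_zero.mpr (mul_ne_zero ha hb)
  calc a * b = 1 * (a * b) * 1 := by ring
    _ ≤ 27 * (a * b) * (a * b) := by nlinarith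
    _ = 27 * a ^ 2 * b ^ 2 := by ring

/-- **Numeric side conditions** implied by the parameter inequalities of `ClassTableInterfaceQ3`. -/
theorem inst_numerics {a b ℓe s npp e k prec sz : ℕ} (ha : a ≠ 0) (hb : b ≠ 0)
    (hk : ℓe + s + npp + 60 + 6 * Nat.size (27 * a ^ 2 * b ^ 2) + e + 2 * sz ≤ k) (hprec : k + s + npp + 64 ≤ prec) :
    4 * Nat.size (a * b) + 8 ≤ prec ∧ 9 ≤ prec ∧ 4 ≤ k ∧ k + s ≤ prec ∧ npp ≤ prec := by
  have hsz := size_ab_le ha hb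
  omega

/-- `1/16 ≤ R_K` from `log 2 / 6 ≤ R_K`. -/
theorem regulator_sixteenth_le {R : ℝ} (hR6 : Real.log 2 / 6 ≤ R) : (1 : ℝ) / 16 ≤ R := by
  have := Real.log_two_gt_d9
  linarith

/-- `log 2 / 6 ≤ R` from a period bound `n₀ log 2 ≤ 6 R` with `n₀ ≥ 1`. -/
theorem regulator_ge_of_period {n₀ : ℕ} (hn₀ : 0 < n₀) {R : ℝ} (h : (n₀ : ℝ) * Real.log 2 ≤ 6 * R) :
    Real.log 2 / 6 ≤ R := by
  have h1 : (1 : ℝ) ≤ n₀ := by exact_mod_cast hn₀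
  have hl := Real.log_two_gt_d9
  nlinarith

/-- `n₀ ≤ 9 d⁶` from `n₀ log 2 ≤ 6 R`, `R ≤ d⁶`. -/
theorem period_le_nine_pow_six {n₀ : ℕ} {R d : ℝ} (h : (n₀ : ℝ) * Real.log 2 ≤ 6 * R) (hRd : R ≤ d ^ 6) (hd : 1 ≤ d) :
    (n₀ : ℝ) ≤ 9 * d ^ 6 := by
  have hl := Real.log_two_gt_d9
  have hd6 : (1 : ℝ) ≤ d ^ 6 := one_le_pow₀ hd
  nlinarith

/-- `LB = log (3 √d) ≤ d⁶` for `d ≥ 2`. -/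
theorem logB_le_pow_six {d : ℝ} (hd : 2 ≤ d) : Real.log (3 * Real.sqrt d) ≤ d ^ 6 := by
  have hs : Real.sqrt d ≤ d := by
    rw [Real.sqrt_le_left (by linarith)]
    nlinarith
  have h1 : Real.log (3 * Real.sqrt d) ≤ 3 * Real.sqrt d - 1 := by
    have hpos : 0 < 3 * Real.sqrt d := by positivity
    linarith [Real.log_le_sub_one_of_pos hpos]
  have hd6 : 3 * d ≤ d ^ 6 := by
    have : (3 : ℝ) ≤ d ^ 5 := by
      calc (3 : ℝ) ≤ 2 ^ 5 := by norm_num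
        _ ≤ d ^ 5 := pow_le_pow_left₀ (by norm_num) hd 5
    nlinarith
  nlinarith

/-- `3/2^prec ≤ LB` for `prec ≥ 9` (`LB ≥ log 3 > 1`). -/
theorem three_div_le_logB {d : ℝ} (hd : 1 ≤ d) {prec : ℕ} (hprec : 9 ≤ prec) :
    (3 : ℝ) / 2 ^ prec ≤ Real.log (3 * Real.sqrt d) := by
  have hs : (1 : ℝ) ≤ Real.sqrt d := by rw [Real.one_le_sqrt]; exact hd
  have h3 : Real.log 3 ≤ Real.log (3 * Real.sqrt d) := Real.log_le_log (by norm_num) (by nlinarith)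
  have hlog3 : 1 ≤ Real.log 3 := by
    rw [Real.le_log_iff_exp_le (by norm_num)]
    have := Real.exp_one_lt_d9
    linarith
  have h2 : (3 : ℝ) / 2 ^ prec ≤ 1 := by
    rw [div_le_one (by positivity)]
    calc (3 : ℝ) ≤ 2 ^ 9 := by norm_num
      _ ≤ 2 ^ prec := pow_le_pow_right₀ (by norm_num) hprec
  linarith

/-- `2^prec / 16 ≤ Rint = r 2^(prec−k)` from the regulator advice `|r − 2^k R| ≤ 1`, `R ≥ log 2/6`, `k ≥ 5`, `k ≤ prec`. -/
theorem Rint_ge {r k prec : ℕ} {R : ℝ} (hr : |(r : ℝ) - 2 ^ k * R| ≤ 1) (hR6 : Real.log 2 / 6 ≤ R) (hk : 5 ≤ k)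
    (hkp : k ≤ prec) : (2 : ℝ) ^ prec / 16 ≤ ((r * 2 ^ (prec - k) : ℕ) : ℝ) := by
  have hl := Real.log_two_gt_d9
  rw [abs_le] at hr
  have h32 : (32 : ℝ) ≤ 2 ^ k := by
    calc (32 : ℝ) = 2 ^ 5 := by norm_num
      _ ≤ 2 ^ k := pow_le_pow_right₀ (by norm_num) hk
  have hr16 : (2 : ℝ) ^ k / 16 ≤ r := by
    have h1 : (2 : ℝ) ^ k * R - 1 ≤ r := by linarith
    have h2 : (2 : ℝ) ^ k * (Real.log 2 / 6) ≤ 2 ^ k * R := mul_le_mul_of_nonneg_left hR6 (by positivity)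
    have h3 : (2 : ℝ) ^ k / 16 ≤ 2 ^ k * (Real.log 2 / 6) - 1 := by nlinarith
    linarith
  have e : (2 : ℝ) ^ prec = 2 ^ k * 2 ^ (prec - k) := by rw [← pow_add]; congr 1; omega
  push_cast
  rw [e]
  have h0 : (0 : ℝ) ≤ 2 ^ (prec - k) := by positivity
  calc (2 : ℝ) ^ k * 2 ^ (prec - k) / 16 = 2 ^ k / 16 * 2 ^ (prec - k) := by ring
    _ ≤ r * 2 ^ (prec - k) := mul_le_mul_of_nonneg_right hr16 h0

/-- `p ≤ cap` from `(243 a² b² (p+1))² ≤ cap` (`a, b ≥ 1`). -/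
theorem prime_le_cap {a b p cap : ℕ} (ha : a ≠ 0) (hb : b ≠ 0) (h : (243 * a ^ 2 * b ^ 2 * (p + 1)) ^ 2 ≤ cap) : p ≤ cap := by
  have h1 : 1 ≤ 243 * a ^ 2 * b ^ 2 := by
    have := Nat.one_le_iff_ne_zero.mpr (mul_ne_zero ha hb)
    calc 1 ≤ a * b := this
      _ ≤ 243 * (a * b) * (a * b) := by nlinarith
      _ = 243 * a ^ 2 * b ^ 2 := by ring
  calc p ≤ p + 1 := Nat.le_succ p
    _ ≤ 243 * a ^ 2 * b ^ 2 * (p + 1) := Nat.le_mul_of_pos_left _ h1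
    _ ≤ (243 * a ^ 2 * b ^ 2 * (p + 1)) ^ 2 := Nat.le_self_pow (by norm_num) _
    _ ≤ cap := h

/-- **P5b helper `classTableSem_inst_pos_decomp`** (registered): the layout of a position of the class table. -/
theorem classTableSem_inst_pos_decomp : ∀ (I : CubicClassTable.Inst) (E j : ℕ), E < I.W → j < 2 ^ I.ℓy → I.Eof (E + I.W * j) = E ∧ I.jof (E + I.W * j) = j ∧ (∀ t, I.digit (E + I.W * j) t = E / (2 ^ I.ℓe) ^ t % 2 ^ I.ℓe) ∧ I.tgt (E + I.W * j) = (j % 2 ^ I.s) * I.r * 2 ^ (I.prec - I.k - I.s) :=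
  fun I _ _ hE hj => inst_pos_decomp I hE hj

end Summit.QuantumAdvantage.QuantumAdvantage.Theorems.LinnikCubicClassGroups
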